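import Summits.ResolutionOfSingularities.ResolutionOfSingularities.Theses.RadicialJung
import Summits.ResolutionOfSingularities.ResolutionOfSingularities.Theorems.RadicialJungCleanModelsClosedPoints
import Summits.ResolutionOfSingularities.ResolutionOfSingularities.Theorems.RadicialJungCleanModelsLooseIffFormal
import Summits.ResolutionOfSingularities.ResolutionOfSingularities.Theorems.RadicialJungCleanModelsStubAlgebraizeDimTwo
import HarnessLib

/-!
# Route `RadicialJung`, crux `CleanModels`: in dimension 2 the crux reduces to FORMAL cleanness

Route `ResolutionOfSingularities/RadicialJung`, crux item `CleanModels`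
(stmt-ResolutionOfSingularities-15917), line `Sketch` rev 9 (lead c1, 2026-08-17).

`CleanModels` asks for a proper birational REGULAR model `V → W` of a degree-`p` radicial extension
`L/K(W)` on which, at every point, a generator `y`, `y^p = g`, has `π^*g` EXACTLY log-clean with
respect to an ALGEBRAIC minimal generating system of `𝔪_v` (Zariski-local). The printed theorems
(Giraud 1983 for surfaces; Cossart 1987 for threefolds over `k̄`) give such normal forms only in
the COMPLETED local rings. This file records the dimension-2 outcome of the line's transfer cut:

* `cleanModels_dimLETwo_of_formalPrincipalization` — **for a regular integral separated `W` of
  finite type over any field `k` of characteristic `p` with `dim W ≤ 2`, the body of `CleanModels`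
  at `(W, L)` follows from FORMALLY clean principalization**: if every `g₀ ∈ K(W) ∖ K(W)^p` admits a
  proper birational regular model on which, at every CLOSED point, some non-trivial representative
  `Σ_{j<p} c_j^p g₀^j` is loosely clean in `Ô_{V,v} = AdicCompletion 𝔪_v O_{V,v}`, then the crux
  holds for every purely inseparable `L/K(W)` of degree `p`.

The Zariski rider ("algebraic `t_i`", the route's recorded risk for this crux) is therefore PAID in
dimension 2, over every ground field: the dimension-2 Zariski descent `stub_algebraizeDimTwo`
(formally clean ⇒ Zariski clean or nodal at closed points of an excellent regular surface; nodal
points are isolated and cured by one point blow-up — Theorems/RadicialJungCleanModelsStub{CleanOrNodalOfFormal,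
FormalFibreReducedStalk,CleanSpreads,NodalBlowup,AlgebraizeDimTwo}.lean), the interface
`looseClean_iff_algebraizedFormalClean`, the Frobenius twist (`stub_frobeniusTwist`) and the
landed generisation/transfer `looseCleanAll_of_closedPoints` + `cleanModels_of_looseCleanAll`.
What remains of the crux in dimension 2 is exactly Giraud's theorem in `Ô`-form over arbitrary
residue fields (the line's open stub `stub_formalPrincipalizationDimGETwo` at `dim W = 2`).
-/

noncomputable section

set_option linter.dupNamespace false -- mandated namespace of this single-conjunct summit

open CategoryTheory AlgebraicGeometry TopologicalSpace IsLocalRing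
open Literature.AlgebraicGeometry.Resolution Literature.AlgebraicGeometry.Motives

namespace Summit.ResolutionOfSingularities.ResolutionOfSingularities.Theorems.RadicialJung.CleanModels

/-- **In dimension `≤ 2`, `CleanModels` at `(W, L)` follows from formally clean principalization
at closed points.** Let `W` be regular integral separated of finite type over a field `k` of
characteristic `p`, `dim W ≤ 2`, and `L/K(W)` purely inseparable of degree `p`. Suppose every
`g₀ ∈ K(W) ∖ K(W)^p` has a proper birational regular model `π : V → W` such that at every closed
`v ∈ V` some non-trivial representative `Σ_{j<p} c_j^p g₀^j` is FORMALLY loosely clean in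
`Ô_{V,v}` (formal toroidal `ι s = û ∏ τ_i^{a_i}` for a minimal generating system `(τ_i)` of
`𝔪̂ = 𝔪 Ô`, `p ∤ a_i`, `m ≥ 1`; or `ι s - ĉ^p ∉ 𝔪̂` for all `ĉ`; or `ι s - ĉ^p ∈ 𝔪̂ ∖ 𝔪̂²` for some
`ĉ`). Then there are an integral `V'` and a proper birational dominant `π' : V' → W` with `V'`
regular on which at EVERY point some `y ∈ L ∖ K(W)`, `y^p = g`, has `π'^* g` exactly clean
(algebraize the formal boundary by the dimension-2 Zariski descent `stub_algebraizeDimTwo`; read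
the representative as `y^p` by `stub_frobeniusTwist`; generise and normalise by
`looseCleanAll_of_closedPoints`, `cleanModels_of_looseCleanAll`). -/
theorem cleanModels_dimLETwo_of_formalPrincipalization (p : ℕ) (hp : p.Prime) (k : Type)
    [Field k] [CharP k p] (W : Scheme.{0}) [IsIntegral W] (f : W ⟶ Spec (.of k)) [IsSeparated f]
    [LocallyOfFiniteType f] [QuasiCompact f] (hW : Scheme.IsRegular W) (L : Type) [Field L]
    [Algebra W.functionField L] [IsPurelyInseparable W.functionField L]
    (hdeg : Module.finrank W.functionField L = p) (hdim : topologicalKrullDim W ≤ 2)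
    (hF : ∀ g₀ : W.functionField, (∀ c : W.functionField, c ^ p ≠ g₀) →
      ∃ (V : Scheme.{0}) (π : V ⟶ W) (_ : IsIntegral V) (_ : IsDominant π),
        IsProper π ∧ IsBirational π ∧ Scheme.IsRegular V ∧
        ∀ v : V, IsClosed ({v} : Set V) →
          ∃ c : Fin p → W.functionField, (∃ j : Fin p, (j : ℕ) ≠ 0 ∧ c j ≠ 0) ∧
          ((∃ (d m : ℕ) (hmd : m ≤ d) (τ : Fin d → AdicCompletion (maximalIdeal (V.presheaf.stalk v)) (V.presheaf.stalk v))
              (a : Fin m → ℕ) (û : AdicCompletion (maximalIdeal (V.presheaf.stalk v)) (V.presheaf.stalk v)) (s : V.presheaf.stalk v), IsUnit û ∧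
              Ideal.span (Set.range τ) = (maximalIdeal (V.presheaf.stalk v)).map (algebraMap (V.presheaf.stalk v) (AdicCompletion (maximalIdeal (V.presheaf.stalk v)) (V.presheaf.stalk v))) ∧
              ringKrullDim (V.presheaf.stalk v) = (d : WithBot ℕ∞) ∧ 0 < m ∧ (∀ i, ¬ p ∣ a i) ∧
              RatFn.functionFieldMap π (∑ j : Fin p, c j ^ p * g₀ ^ (j : ℕ)) = algebraMap (V.presheaf.stalk v) V.functionField s ∧
              algebraMap (V.presheaf.stalk v) (AdicCompletion (maximalIdeal (V.presheaf.stalk v)) (V.presheaf.stalk v)) s = û * ∏ i : Fin m, τ (Fin.castLE hmd i) ^ (a i)) ∨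
            (∃ u : V.presheaf.stalk v, IsUnit u ∧ RatFn.functionFieldMap π (∑ j : Fin p, c j ^ p * g₀ ^ (j : ℕ)) = algebraMap (V.presheaf.stalk v) V.functionField u ∧
              ∀ ĉ : AdicCompletion (maximalIdeal (V.presheaf.stalk v)) (V.presheaf.stalk v),
                algebraMap (V.presheaf.stalk v) (AdicCompletion (maximalIdeal (V.presheaf.stalk v)) (V.presheaf.stalk v)) u - ĉ ^ p ∉ (maximalIdeal (V.presheaf.stalk v)).map (algebraMap (V.presheaf.stalk v) (AdicCompletion (maximalIdeal (V.presheaf.stalk v)) (V.presheaf.stalk v)))) ∨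
            (∃ (s : V.presheaf.stalk v) (ĉ : AdicCompletion (maximalIdeal (V.presheaf.stalk v)) (V.presheaf.stalk v)), RatFn.functionFieldMap π (∑ j : Fin p, c j ^ p * g₀ ^ (j : ℕ)) = algebraMap (V.presheaf.stalk v) V.functionField s ∧
              algebraMap (V.presheaf.stalk v) (AdicCompletion (maximalIdeal (V.presheaf.stalk v)) (V.presheaf.stalk v)) s - ĉ ^ p ∈ (maximalIdeal (V.presheaf.stalk v)).map (algebraMap (V.presheaf.stalk v) (AdicCompletion (maximalIdeal (V.presheaf.stalk v)) (V.presheaf.stalk v))) ∧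
              algebraMap (V.presheaf.stalk v) (AdicCompletion (maximalIdeal (V.presheaf.stalk v)) (V.presheaf.stalk v)) s - ĉ ^ p ∉ (maximalIdeal (V.presheaf.stalk v)).map (algebraMap (V.presheaf.stalk v) (AdicCompletion (maximalIdeal (V.presheaf.stalk v)) (V.presheaf.stalk v))) ^ 2))) :
    ∃ (V : Scheme.{0}) (π : V ⟶ W) (_ : IsIntegral V) (_ : IsDominant π),
      IsProper π ∧ IsBirational π ∧ Scheme.IsRegular V ∧
      (∀ v : V, (∃ (y : L) (g : W.functionField), y ∉ Set.range (algebraMap W.functionField L) ∧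
        algebraMap W.functionField L g = y ^ p ∧
        ((∃ (d m : ℕ) (hmd : m ≤ d) (t : Fin d → V.presheaf.stalk v) (a : Fin m → ℕ),
            Ideal.span (Set.range t) = maximalIdeal (V.presheaf.stalk v) ∧
            ringKrullDim (V.presheaf.stalk v) = (d : WithBot ℕ∞) ∧ 0 < m ∧ (∀ i, ¬ p ∣ a i) ∧
            RatFn.functionFieldMap π g = ∏ i : Fin m,
              (algebraMap (V.presheaf.stalk v) V.functionField (t (Fin.castLE hmd i))) ^ (a i)) ∨
          (∃ u₀ : V.presheaf.stalk v, IsUnit u₀ ∧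
            RatFn.functionFieldMap π g = algebraMap (V.presheaf.stalk v) V.functionField u₀ ∧
            ((∀ c : V.presheaf.stalk v, u₀ - c ^ p ∉ maximalIdeal (V.presheaf.stalk v)) ∨
              (∃ c : V.presheaf.stalk v, u₀ - c ^ p ∈ maximalIdeal (V.presheaf.stalk v) ∧
                u₀ - c ^ p ∉ maximalIdeal (V.presheaf.stalk v) ^ 2)))))) := by
  haveI : Fact p.Prime := ⟨hp⟩
  haveI : CharP W.functionField p := charP_stalk W f _
  -- a generator `y₀`, `y₀^p = g₀ ∉ K(W)^p`
  obtain ⟨-, y₀, g₀, hy₀, hg₀, hg₀p⟩ := stub_generator (K := W.functionField) (L := L) p hp hdeg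
  -- the formally clean model and its algebraization (dimension-2 Zariski descent)
  obtain ⟨V, π, hVint, hπdom, hπprop, hπbir, hVreg, hformal⟩ := hF g₀ hg₀p
  haveI := hVint; haveI := hπdom; haveI := hπprop
  obtain ⟨V', π', hV'int, hπ'dom, hπ'prop, hπ'bir, hV'reg, halg⟩ :=
    stub_algebraizeDimTwo p hp k W f hW g₀ hg₀p hdim V π hπbir hVreg hformal
  haveI := hV'int; haveI := hπ'dom; haveI := hπ'prop
  -- loosely clean at closed points, read in `L`
  have hclosed : ∀ v : V', IsClosed ({v} : Set V') → ∃ (y : L) (g : W.functionField),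
      y ∉ Set.range (algebraMap W.functionField L) ∧ algebraMap W.functionField L g = y ^ p ∧
      ((∃ (d m : ℕ) (hmd : m ≤ d) (t : Fin d → V'.presheaf.stalk v) (a : Fin m → ℕ)
          (u : V'.presheaf.stalk v), IsUnit u ∧
          Ideal.span (Set.range t) = maximalIdeal (V'.presheaf.stalk v) ∧
          ringKrullDim (V'.presheaf.stalk v) = (d : WithBot ℕ∞) ∧ 0 < m ∧ (∀ i, ¬ p ∣ a i) ∧
          RatFn.functionFieldMap π' g = algebraMap (V'.presheaf.stalk v) V'.functionField
            (u * ∏ i : Fin m, t (Fin.castLE hmd i) ^ (a i))) ∨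
        (∃ u : V'.presheaf.stalk v, IsUnit u ∧
          RatFn.functionFieldMap π' g = algebraMap (V'.presheaf.stalk v) V'.functionField u ∧
          ∀ c : V'.presheaf.stalk v, u - c ^ p ∉ maximalIdeal (V'.presheaf.stalk v)) ∨
        (∃ s c : V'.presheaf.stalk v,
          RatFn.functionFieldMap π' g = algebraMap (V'.presheaf.stalk v) V'.functionField s ∧
          s - c ^ p ∈ maximalIdeal (V'.presheaf.stalk v) ∧
          s - c ^ p ∉ maximalIdeal (V'.presheaf.stalk v) ^ 2)) := by
    intro v hv
    obtain ⟨c, ⟨j₀, hj₀, hc⟩, hcase⟩ := halg v hv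
    haveI : IsRegularLocalRing (V'.presheaf.stalk v) := hV'reg v
    haveI : CharP (V'.presheaf.stalk v) p := charP_stalk V' (π' ≫ f) v
    have hloose := (looseClean_iff_algebraizedFormalClean p hp _).mpr hcase
    obtain ⟨y, hy, hyp⟩ := stub_frobeniusTwist (K := W.functionField) (L := L) p hp y₀ g₀ hy₀ hg₀
      c j₀ hj₀ hc 1 one_ne_zero 0 (Nat.zero_le 1)
    refine ⟨y, ∑ j : Fin p, c j ^ p * g₀ ^ (j : ℕ), hy, ?_, hloose⟩
    rw [one_pow, one_mul, Nat.cast_zero, add_zero] at hyp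
    exact hyp
  refine ⟨V', π', hV'int, hπ'dom, hπ'prop, hπ'bir, hV'reg, fun v => ?_⟩
  exact cleanModels_of_looseCleanAll p hp k W f L V' π' hπ'bir
    (looseCleanAll_of_closedPoints p hp k W f L V' π' hπ'bir hV'reg hclosed) v

end Summit.ResolutionOfSingularities.ResolutionOfSingularities.Theorems.RadicialJung.CleanModels

end
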